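import Mathlib.Analysis.SpecificLimits.Normed
import Mathlib.Analysis.Complex.Basic
import Mathlib.Topology.Algebra.Polynomial
import Mathlib.RingTheory.Algebraic.Basic
import Mathlib.Algebra.Polynomial.Eval.Defs
import HarnessLib

/-!
# The limit value of a bounded coordinate along an unbounded one is algebraic

Let `P ∈ ℚ[Y][X]` be a nonzero bivariate rational polynomial and let `(u_n, v_n)` be complex
solutions of `P(X = u_n, Y = v_n) = 0` with `|u_n| → ∞` and `v_n → b`. Then `b` is algebraic:
writing `P = Σ_k c_k(Y) X^k` with `c_K ≠ 0` the top coefficient, `c_K(b) = 0`, for otherwise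
`|c_K(v_n)| ≥ δ > 0` eventually and the top term `c_K(v_n) u_n^K` dominates the rest
(`isAlgebraic_of_tendsto_of_eval₂_eq_zero`).

This is how the values `y_j(P) = lim y_j` of the bounded coordinates at a place at infinity of a
ℚ-curve are seen to be algebraic once a rational relation `P(x_i, y_j) = 0` between an unbounded
coordinate `x_i` and `y_j` is known (crux `RigidCore.SparsityTwo`, line cusp-germ-schneider-sparsity,
arithmetic normal form of a cusp germ). [folklore]
-/

noncomputable section

open Filter Polynomial
open _root_.Topology

namespace Literature.NumberTheory.Transcendental

/-- Domination of the top term: if `|a_K| ≥ δ > 0`, `Σ_{k<K} |a_k| ≤ S` and `|x| ≥ 1`,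
`δ |x| > S`, then `Σ_{k ≤ K} a_k x^k ≠ 0`. [folklore] -/
theorem sum_range_succ_mul_pow_ne_zero {K : ℕ} (a : ℕ → ℂ) {x : ℂ} {δ S : ℝ}
    (hδ : δ ≤ ‖a K‖) (hS : ∑ k ∈ Finset.range K, ‖a k‖ ≤ S) (hx1 : 1 ≤ ‖x‖)
    (hx : S < δ * ‖x‖) : ∑ k ∈ Finset.range (K + 1), a k * x ^ k ≠ 0 := by
  intro h0
  rw [Finset.sum_range_succ] at h0
  -- the tail is bounded by `S |x|^(K-1) |x|^0…`; we use the cruder `S |x|^K / |x|`-free form: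
  -- `|Σ_{k<K} a_k x^k| ≤ Σ_{k<K} |a_k| |x|^k ≤ (Σ_{k<K} |a_k|) |x|^K / |x|`… organised as follows.
  have hxpos : 0 < ‖x‖ := lt_of_lt_of_le one_pos hx1
  have htop : ‖a K * x ^ K‖ = ‖a K‖ * ‖x‖ ^ K := by rw [norm_mul, norm_pow]
  -- each lower term: |a_k x^k| ≤ |a_k| |x|^K / |x|   (k < K, |x| ≥ 1)
  have hlow : ∀ k ∈ Finset.range K, ‖a k * x ^ k‖ ≤ ‖a k‖ * (‖x‖ ^ K / ‖x‖) := by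
    intro k hk
    rw [Finset.mem_range] at hk
    rw [norm_mul, norm_pow]
    refine mul_le_mul_of_nonneg_left ?_ (norm_nonneg _)
    rw [le_div_iff₀ hxpos, ← pow_succ]
    exact pow_le_pow_right₀ hx1 (by omega)
  have htail : ‖∑ k ∈ Finset.range K, a k * x ^ k‖ ≤ S * (‖x‖ ^ K / ‖x‖) := by
    calc ‖∑ k ∈ Finset.range K, a k * x ^ k‖
        ≤ ∑ k ∈ Finset.range K, ‖a k * x ^ k‖ := norm_sum_le _ _
      _ ≤ ∑ k ∈ Finset.range K, ‖a k‖ * (‖x‖ ^ K / ‖x‖) := Finset.sum_le_sum hlow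
      _ = (∑ k ∈ Finset.range K, ‖a k‖) * (‖x‖ ^ K / ‖x‖) := by rw [Finset.sum_mul]
      _ ≤ S * (‖x‖ ^ K / ‖x‖) := by
          refine mul_le_mul_of_nonneg_right hS ?_
          positivity
  -- from `tail + top = 0`: |top| = |tail|
  have heq : ‖a K * x ^ K‖ = ‖∑ k ∈ Finset.range K, a k * x ^ k‖ := by
    have : a K * x ^ K = -∑ k ∈ Finset.range K, a k * x ^ k := eq_neg_of_add_eq_zero_right h0
    rw [this, norm_neg]
  have hK : ‖x‖ ^ K = ‖x‖ ^ K / ‖x‖ * ‖x‖ := by field_simp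
  have h1 : δ * ‖x‖ * (‖x‖ ^ K / ‖x‖) ≤ S * (‖x‖ ^ K / ‖x‖) := by
    calc δ * ‖x‖ * (‖x‖ ^ K / ‖x‖) = δ * ‖x‖ ^ K := by rw [mul_assoc, mul_comm ‖x‖, ← hK]
      _ ≤ ‖a K‖ * ‖x‖ ^ K := mul_le_mul_of_nonneg_right hδ (by positivity)
      _ = ‖∑ k ∈ Finset.range K, a k * x ^ k‖ := by rw [← htop, heq]
      _ ≤ S * (‖x‖ ^ K / ‖x‖) := htail
  have hpos : 0 < ‖x‖ ^ K / ‖x‖ := by positivity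
  have := le_of_mul_le_mul_right h1 hpos
  linarith

/-- **The limit of the bounded coordinate is algebraic.** Let `P ∈ ℚ[Y][X]` be nonzero and let
`u v : ℕ → ℂ` with `‖u n‖ → ∞`, `v n → b`, and `P(u n, v n) = 0` for all `n` (evaluation: map the
coefficients into `ℂ[Y]`, substitute `Y = v n`, then `X = u n`). Then `b` is algebraic over `ℚ`.
[folklore] -/
theorem isAlgebraic_of_tendsto_of_eval₂_eq_zero (P : Polynomial (Polynomial ℚ)) (hP : P ≠ 0)
    {u v : ℕ → ℂ} {b : ℂ} (hu : Tendsto (fun n => ‖u n‖) atTop atTop)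
    (hv : Tendsto v atTop (𝓝 b))
    (h : ∀ n, (P.map (mapRingHom (algebraMap ℚ ℂ))).eval₂ (evalRingHom (v n)) (u n) = 0) :
    IsAlgebraic ℚ b := by
  classical
  set Q : Polynomial (Polynomial ℂ) := P.map (mapRingHom (algebraMap ℚ ℂ)) with hQ
  have hQ0 : Q ≠ 0 := by
    rw [hQ]
    exact (Polynomial.map_ne_zero_iff (Polynomial.map_injective _ (algebraMap ℚ ℂ).injective)).mpr hP
  set K := Q.natDegree with hK
  -- coefficients as functions of `y`
  set c : ℕ → ℂ → ℂ := fun k y => (Q.coeff k).eval y with hc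
  have heval : ∀ n, ∑ k ∈ Finset.range (K + 1), c k (v n) * (u n) ^ k = 0 := by
    intro n
    have := h n
    rw [Polynomial.eval₂_eq_sum_range] at this
    simpa [hc, hK, coe_evalRingHom] using this
  -- the top coefficient, a nonzero rational polynomial in `Y`
  have htopQ : Q.coeff K = (P.coeff K).map (algebraMap ℚ ℂ) := by
    rw [hQ, Polynomial.coeff_map, coe_mapRingHom]
  have hlead : Q.coeff K ≠ 0 := by
    rw [hK]
    exact Polynomial.leadingCoeff_ne_zero.mpr hQ0
  have hPK : P.coeff K ≠ 0 := by
    intro h0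
    exact hlead (by rw [htopQ, h0, Polynomial.map_zero])
  -- claim: `c K b = 0`
  suffices hroot : c K b = 0 by
    refine ⟨P.coeff K, hPK, ?_⟩
    have : (Polynomial.aeval b) (P.coeff K) = c K b := by
      rw [hc]
      simp only [htopQ, Polynomial.eval_map, Polynomial.aeval_def]
    rw [this, hroot]
  by_contra hne
  -- continuity of the coefficients along `v n → b`
  have hcont : ∀ k, Tendsto (fun n => c k (v n)) atTop (𝓝 (c k b)) := fun k =>
    ((Q.coeff k).continuous.tendsto b).comp hv
  set δ : ℝ := ‖c K b‖ / 2 with hδ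
  have hδpos : 0 < δ := by
    have : 0 < ‖c K b‖ := norm_pos_iff.mpr hne
    rw [hδ]; linarith
  have hbig : ∀ᶠ n in atTop, δ ≤ ‖c K (v n)‖ := by
    have h1 : Tendsto (fun n => ‖c K (v n)‖) atTop (𝓝 ‖c K b‖) := (hcont K).norm
    have h2 : δ < ‖c K b‖ := by rw [hδ]; linarith [norm_pos_iff.mpr hne]
    exact (h1.eventually (lt_mem_nhds h2)).mono fun n hn => hn.le
  set S : ℝ := ∑ k ∈ Finset.range K, (‖c k b‖ + 1) with hS
  have hsmall : ∀ᶠ n in atTop, ∑ k ∈ Finset.range K, ‖c k (v n)‖ ≤ S := by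
    have hk : ∀ k, ∀ᶠ n in atTop, ‖c k (v n)‖ ≤ ‖c k b‖ + 1 := by
      intro k
      have h1 : Tendsto (fun n => ‖c k (v n)‖) atTop (𝓝 ‖c k b‖) := (hcont k).norm
      exact (h1.eventually (gt_mem_nhds (lt_add_one _))).mono fun n hn => hn.le
    have hall : ∀ᶠ n in atTop, ∀ k ∈ Finset.range K, ‖c k (v n)‖ ≤ ‖c k b‖ + 1 :=
      (Finset.eventually_all (Finset.range K)).mpr fun k _ => hk k
    filter_upwards [hall] with n hn
    exact Finset.sum_le_sum hn
  have hx1 : ∀ᶠ n in atTop, 1 ≤ ‖u n‖ := hu.eventually (eventually_ge_atTop 1)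
  have hx : ∀ᶠ n in atTop, S < δ * ‖u n‖ := by
    have : Tendsto (fun n => δ * ‖u n‖) atTop atTop := hu.const_mul_atTop hδpos
    exact this.eventually (eventually_gt_atTop S)
  obtain ⟨n, hn⟩ := (((hbig.and hsmall).and hx1).and hx).exists
  exact sum_range_succ_mul_pow_ne_zero (fun k => c k (v n)) hn.1.1.1 hn.1.1.2 hn.1.2 hn.2 (heval n)

end Literature.NumberTheory.Transcendental

end
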